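import Literature.Probability.LatticeModels.TreeGraphWickBound
import Literature.Probability.LatticeModels.AizenmanWickBound
import HarnessLib

/-!
# Deviation from Wick's law, tree-diagram form — III: identification with `pairingSum` / `wickRemainder`

Topic `Literature/Probability/LatticeModels`. Sibling of `TreeGraphWickBound.lean`, which proves for the current
ratios `W(A) = Z_K[A]/Z_K[∅]` (`K ≥ 0` on a finite simple graph) and every vertex set `B` of even size
`|W(B) - fsPairing W₂ B| ≤ 2 fsRemainder T W₂ B` with the SUBSET-indexed pairing functional `fsPairing`
(expansion at the least element of a linear order). This file identifies the subset-indexed objects with the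
tree's ordering-average functional `pairingSum` (`HighDimTrivialityWick`) and remainder `wickRemainder`
(`AizenmanWickBound`) and removes the linear order from the statement:

* `linearOrderOfInjective` — a linear order pulled back along an injection whose `DecidableEq` field is the
  ambient instance (so no instance transport is needed downstream);
* `fsPairing_eq_sum_erase` — expansion of `fsPairing` at an ARBITRARY element (symmetric `S₂`), whence
  `fsPairing_map` / `fsRemainder_map` (relabelling invariance along injections);
* `fsPairing_univ_eq_pairingSum` — `fsPairing (S₂∘(x×x)) univ = pairingSum S₂ n x` for every `x : Fin (2n) → α`
  (first-pair recursion `pairingSum_succ` = average over the position of the first point, matched with the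
  expansion at that position); `fsRemainder_univ_eq_wickRemainder`;
* `Current.abs_ratio_image_sub_pairingSum_le` — for an injective `x : Fin (2n) → V` (plain `[DecidableEq V]`),
  `|W({x_i}) - 𝒢_n[W₂](x)| ≤ 2 · wickRemainder W₂ T n x`, `T(u) = ∑_v ∏_j W₂(u_j, v)`: the tree-diagram form of
  Aizenman's bound on the deviation from Wick's law (Aizenman 1982, Prop. 12.1 with Prop. 5.3; Panis 2023,
  Prop. 4.6 with §4.2), constant `2`, distinct points.

Coincident points (for pair-interaction Gibbs states) are treated in `TreeGraphWickPairInteraction.lean`.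

## References

* M. Aizenman, Comm. Math. Phys. 86 (1982), Prop. 5.3, Prop. 12.1 [AizenmanCMP1982].
* R. Panis, arXiv:2309.05797 (2023), Prop. 4.6, §4.2 [Panis2023Triviality].
* M. Aizenman, H. Duminil-Copin, Ann. of Math. 194 (2021), arXiv:1912.07973, §1.1 (`𝒢_n`) [AizenmanDuminilCopinAnnals2021].
-/

noncomputable section

open Finset
open scoped symmDiff

namespace Literature.Probability.LatticeModels

/-! ### A linear order with prescribed decidable equality -/

/-- A linear order on `α` pulled back along an injection into a linear order, whose `DecidableEq` field
is the ambient instance (so that `Finset` operations elaborated with the ambient instance match the ones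
coming from the order; compare `LinearOrder.lift'`). [folklore] -/
abbrev linearOrderOfInjective {α β : Type*} [DecidableEq α] [LinearOrder β] (f : α → β)
    (hf : Function.Injective f) : LinearOrder α :=
  letI : PartialOrder α := PartialOrder.lift f hf
  letI : DecidableLE α := fun a b => (inferInstance : Decidable (f a ≤ f b))
  letI : DecidableLT α := fun a b => (inferInstance : Decidable (f a < f b))
  { (inferInstance : PartialOrder α) with
    le_total := fun a b => le_total (f a) (f b)
    toDecidableLE := inferInstance
    toDecidableEq := ‹DecidableEq α›
    toDecidableLT := inferInstance
    min := fun a b => if a ≤ b then a else b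
    max := fun a b => if a ≤ b then b else a
    min_def := fun _ _ => rfl
    max_def := fun _ _ => rfl
    compare := fun a b => compareOfLessAndEq a b
    compare_eq_compareOfLessAndEq := fun _ _ => rfl }

/-! ### Expansion of the pairing functional at an arbitrary element -/

section AnyPoint

variable {ι : Type*} [LinearOrder ι]

omit [LinearOrder ι] in
/-- Four successive erasures commute. [folklore] -/
theorem erase_four_comm [DecidableEq ι] (B : Finset ι) (a b c d : ι) :
    (((B.erase a).erase b).erase c).erase d = (((B.erase c).erase d).erase a).erase b := by
  ext w
  simp only [Finset.mem_erase]
  tauto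

/-- **Expansion at an arbitrary element**: for a symmetric `S₂` and `p ∈ B`,
`𝒢(B) = ∑_{i∈B∖p} S₂(p,i) 𝒢(B∖{p,i})` (so `𝒢` does not depend on the order used to define it). [folklore] -/
theorem fsPairing_eq_sum_erase (S₂ : ι → ι → ℝ) (hS : ∀ a b, S₂ a b = S₂ b a) {B : Finset ι} {p : ι}
    (hp : p ∈ B) : fsPairing S₂ B = ∑ i ∈ B.erase p, S₂ p i * fsPairing S₂ ((B.erase p).erase i) := by
  induction B using Finset.strongInduction generalizing p with
  | H B ih =>
    have hB : B.Nonempty := ⟨p, hp⟩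
    set m := B.min' hB with hm
    have hmB : m ∈ B := B.min'_mem hB
    by_cases hpm : p = m
    · subst hpm; exact fsPairing_eq S₂ hB
    -- expand the left side at `m`, then every term with `j ≠ p` at `p`
    have hL : fsPairing S₂ B = S₂ m p * fsPairing S₂ ((B.erase m).erase p) +
        ∑ j ∈ (B.erase m).erase p, ∑ i ∈ ((B.erase m).erase p).erase j,
          S₂ m j * (S₂ p i * fsPairing S₂ ((((B.erase m).erase j).erase p).erase i)) := by
      rw [fsPairing_eq S₂ hB, ← hm, ← Finset.add_sum_erase _ _ (Finset.mem_erase.2 ⟨hpm, hp⟩)]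
      congr 1
      refine Finset.sum_congr rfl fun j hj => ?_
      have hjp : j ≠ p := Finset.ne_of_mem_erase hj
      have hjm : j ≠ m := Finset.ne_of_mem_erase (Finset.mem_of_mem_erase hj)
      have hpj : p ∈ (B.erase m).erase j := Finset.mem_erase.2 ⟨hjp.symm, Finset.mem_erase.2 ⟨hpm, hp⟩⟩
      rw [ih _ (erase_erase_ssubset hmB j) hpj, Finset.mul_sum, Finset.erase_right_comm (a := j) (b := p)]
    -- expand the right side: the term `i = m`, and every term with `i ≠ m` at its least element `m`
    have hR : ∑ i ∈ B.erase p, S₂ p i * fsPairing S₂ ((B.erase p).erase i) =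
        S₂ p m * fsPairing S₂ ((B.erase p).erase m) +
          ∑ i ∈ (B.erase p).erase m, ∑ j ∈ ((B.erase p).erase m).erase i,
            S₂ p i * (S₂ m j * fsPairing S₂ ((((B.erase p).erase i).erase m).erase j)) := by
      rw [← Finset.add_sum_erase _ _ (Finset.mem_erase.2 ⟨Ne.symm hpm, hmB⟩)]
      congr 1
      refine Finset.sum_congr rfl fun i hi => ?_
      have him : i ≠ m := Finset.ne_of_mem_erase hi
      have hip : i ≠ p := Finset.ne_of_mem_erase (Finset.mem_of_mem_erase hi)
      have hne : ((B.erase p).erase i).Nonempty := ⟨m, Finset.mem_erase.2 ⟨him.symm, Finset.mem_erase.2 ⟨Ne.symm hpm, hmB⟩⟩⟩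
      have hmin : ((B.erase p).erase i).min' hne = m :=
        min'_eq_of_subset hB hne ((Finset.erase_subset _ _).trans (Finset.erase_subset _ _))
          (Finset.mem_erase.2 ⟨him.symm, Finset.mem_erase.2 ⟨Ne.symm hpm, hmB⟩⟩)
      rw [fsPairing_eq S₂ hne, Finset.mul_sum]
      simp only [hmin]
      rw [Finset.erase_right_comm (a := i) (b := m)]
    rw [hL, hR, hS m p, Finset.erase_right_comm (a := m) (b := p)]
    congr 1
    have hex : ∑ j ∈ (B.erase p).erase m, ∑ i ∈ ((B.erase p).erase m).erase j,
          S₂ m j * (S₂ p i * fsPairing S₂ ((((B.erase m).erase j).erase p).erase i)) =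
        ∑ i ∈ (B.erase p).erase m, ∑ j ∈ ((B.erase p).erase m).erase i,
          S₂ m j * (S₂ p i * fsPairing S₂ ((((B.erase m).erase j).erase p).erase i)) := by
      refine Finset.sum_comm' fun j i => ?_
      simp only [Finset.mem_erase]
      tauto
    rw [hex]
    refine Finset.sum_congr rfl fun i _ => Finset.sum_congr rfl fun j _ => ?_
    rw [erase_four_comm B m j p i]
    ring

/-- **Relabelling invariance**: for a symmetric `S₂` and an injection `e` between linearly ordered index
types, `𝒢[S₂ ∘ (e×e)](B) = 𝒢[S₂](e(B))`. [folklore] -/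
theorem fsPairing_map {ι' : Type*} [LinearOrder ι'] (S₂ : ι → ι → ℝ) (hS : ∀ a b, S₂ a b = S₂ b a)
    (e : ι' ↪ ι) (B : Finset ι') :
    fsPairing (fun a b => S₂ (e a) (e b)) B = fsPairing S₂ (B.map e) := by
  induction B using Finset.strongInduction with
  | H B ih =>
    by_cases hB : B.Nonempty
    · set m := B.min' hB with hm
      have hmB : m ∈ B := B.min'_mem hB
      rw [fsPairing_eq _ hB, ← hm, fsPairing_eq_sum_erase S₂ hS (Finset.mem_map_of_mem e hmB),
        ← Finset.map_erase, Finset.sum_map]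
      refine Finset.sum_congr rfl fun j _ => ?_
      rw [ih _ (erase_erase_ssubset hmB j), ← Finset.map_erase]
    · rw [Finset.not_nonempty_iff_eq_empty.1 hB, Finset.map_empty, fsPairing_empty, fsPairing_empty]

/-- Relabelling invariance of the tree remainder. [folklore] -/
theorem fsRemainder_map {ι' : Type*} [LinearOrder ι'] (T : Finset ι → ℝ) (S₂ : ι → ι → ℝ)
    (hS : ∀ a b, S₂ a b = S₂ b a) (e : ι' ↪ ι) (B : Finset ι') :
    fsRemainder (fun s => T (s.map e)) (fun a b => S₂ (e a) (e b)) B = fsRemainder T S₂ (B.map e) := by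
  unfold fsRemainder
  rw [Finset.powersetCard_map, Finset.sum_map]
  refine Finset.sum_congr rfl fun s _ => ?_
  show T (s.map e) * _ = T (s.map e) * fsPairing S₂ (B.map e \ s.map e)
  rw [fsPairing_map S₂ hS e, Finset.map_sdiff]

end AnyPoint

/-! ### Identification with the ordering-average pairing functional `pairingSum` -/

section Bridge

variable {α : Type*}

/-- `q ↦ b(p,q) = pairPerm p q 1` is injective. [folklore] -/
theorem pairPerm_one_injective {m : ℕ} (p : Fin (m + 2)) : Function.Injective fun q : Fin (m + 1) => pairPerm p q 1 := by
  intro q q' h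
  simp only [pairPerm_one] at h
  exact Fin.succ_injective _ ((Equiv.swap 0 p).injective h)

/-- The remaining indices `pairRest p q` enumerate the complement of `{p, b(p,q)}`. [folklore] -/
theorem map_univ_pairRest {m : ℕ} (p : Fin (m + 2)) (q : Fin (m + 1)) :
    (univ : Finset (Fin m)).map ⟨pairRest p q, pairRest_injective p q⟩ =
      ((univ : Finset (Fin (m + 2))).erase p).erase (pairPerm p q 1) := by
  refine Finset.eq_of_subset_of_card_le (fun y hy => ?_) ?_
  · obtain ⟨j, -, rfl⟩ := Finset.mem_map.1 hy
    simp only [Function.Embedding.coeFn_mk, Finset.mem_erase, Finset.mem_univ, and_true]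
    refine ⟨fun h => ?_, fun h => ?_⟩
    · have h' : pairPerm p q j.succ.succ = pairPerm p q 1 := h
      exact absurd (Fin.succ_injective _ ((pairPerm p q).injective h')) (Fin.succ_ne_zero j)
    · have h' : pairPerm p q j.succ.succ = pairPerm p q 0 := h.trans (pairPerm_zero p q).symm
      exact absurd ((pairPerm p q).injective h') (Fin.succ_ne_zero _)
  · rw [Finset.card_erase_of_mem (Finset.mem_erase.2 ⟨pairPerm_one_ne p q, Finset.mem_univ _⟩),
      Finset.card_erase_of_mem (Finset.mem_univ p), Finset.card_map, Finset.card_univ, Finset.card_univ,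
      Fintype.card_fin, Fintype.card_fin]
    omega

/-- Reindexing a sum over `q` by the partner index `b(p,q)`, which runs over the indices `≠ p`. [folklore] -/
theorem sum_pairPerm_one_eq_sum_erase {M : Type*} [AddCommMonoid M] {m : ℕ} (p : Fin (m + 2)) (f : Fin (m + 2) → M) :
    ∑ q : Fin (m + 1), f (pairPerm p q 1) = ∑ i ∈ (univ : Finset (Fin (m + 2))).erase p, f i := by
  refine Finset.sum_nbij (fun q => pairPerm p q 1) (fun q _ => Finset.mem_erase.2 ⟨pairPerm_one_ne p q, Finset.mem_univ _⟩)
    (fun q _ q' _ h => pairPerm_one_injective p h) (fun i hi => ?_) (fun _ _ => rfl)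
  obtain ⟨q, hq⟩ := exists_pairPerm_one_eq p (Finset.ne_of_mem_erase (Finset.mem_coe.1 hi))
  exact ⟨q, Finset.mem_coe.2 (Finset.mem_univ q), hq⟩

/-- **The subset-indexed pairing functional is the tree's `pairingSum`**: for a symmetric `S₂` and
`x : Fin (2n) → α`, `fsPairing (S₂ ∘ (x×x)) univ = 𝒢_n[S₂](x)` (`pairingSum`, the average over the
`(2n)!` orderings). Proof: the first-pair recursion `pairingSum_succ` (an average over the position `p`
of the first point), the expansion of `fsPairing` at the same index `p` (`fsPairing_eq_sum_erase`) and
relabelling invariance along `pairRest p q`. [cite: AizenmanDuminilCopinAnnals2021, arXiv:1912.07973 §1.1, display defining 𝒢_n (p. 3)] -/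
theorem fsPairing_univ_eq_pairingSum (S₂ : α → α → ℝ) (hS : ∀ a b, S₂ a b = S₂ b a) :
    ∀ (n : ℕ) (x : Fin (2 * n) → α), fsPairing (fun i j => S₂ (x i) (x j)) (univ : Finset (Fin (2 * n))) = pairingSum S₂ n x := by
  intro n
  induction n with
  | zero =>
    intro x
    have h0 : (univ : Finset (Fin (2 * 0))) = ∅ := Finset.eq_empty_of_forall_notMem fun i _ => i.elim0
    rw [pairingSum_zero, h0, fsPairing_empty]
  | succ k ih =>
    intro x
    rw [pairingSum_succ]
    have hS' : ∀ a b : Fin (2 * k + 2), S₂ (x a) (x b) = S₂ (x b) (x a) := fun a b => hS _ _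
    have hp : ∀ p : Fin (2 * k + 2),
        ∑ q : Fin (2 * k + 1), S₂ (x p) (x (pairPerm p q 1)) * pairingSum S₂ k (x ∘ pairRest p q) =
          fsPairing (fun i j => S₂ (x i) (x j)) univ := by
      intro p
      have hq : ∀ q : Fin (2 * k + 1), pairingSum S₂ k (x ∘ pairRest p q) =
          fsPairing (fun i j => S₂ (x i) (x j)) ((univ.erase p).erase (pairPerm p q 1)) := by
        intro q
        rw [← ih (x ∘ pairRest p q), ← map_univ_pairRest p q,
          ← fsPairing_map (fun i j => S₂ (x i) (x j)) hS' ⟨pairRest p q, pairRest_injective p q⟩]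
        rfl
      simp_rw [hq]
      rw [sum_pairPerm_one_eq_sum_erase p (fun i => S₂ (x p) (x i) * fsPairing (fun i j => S₂ (x i) (x j)) ((univ.erase p).erase i))]
      exact (fsPairing_eq_sum_erase _ hS' (Finset.mem_univ p)).symm
    simp_rw [hp]
    rw [Finset.sum_const, Finset.card_univ, Fintype.card_fin, nsmul_eq_mul, ← mul_assoc]
    have hc : ((2 * (k + 1) : ℕ) : ℝ)⁻¹ * ((2 * k + 2 : ℕ) : ℝ) = 1 := by
      rw [inv_mul_eq_div, div_eq_one_iff_eq (by positivity)]
      push_cast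
      ring
    rw [hc, one_mul]

/-- The remaining points `removeFour₂ x s` as `x` along an injection enumerating `sᶜ`. [folklore] -/
theorem removeFour₂_eq_comp {n : ℕ} (x : Fin (2 * n) → α) (s : {s : Finset (Fin (2 * n)) // s.card = 4}) :
    removeFour₂ x s = x ∘ fun j => s.1ᶜ.orderEmbOfFin (card_compl_of_card_eq_four s) (Fin.cast (two_mul_sub_two n) j) := rfl

/-- The enumeration of `sᶜ` used by `removeFour₂`, as an embedding. [folklore] -/
def complEnum {n : ℕ} (s : {s : Finset (Fin (2 * n)) // s.card = 4}) : Fin (2 * (n - 2)) ↪ Fin (2 * n) :=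
  ⟨fun j => s.1ᶜ.orderEmbOfFin (card_compl_of_card_eq_four s) (Fin.cast (two_mul_sub_two n) j), fun i j h => by
    have h' := (s.1ᶜ.orderEmbOfFin (card_compl_of_card_eq_four s)).injective h
    exact (Fin.cast_injective _) h'⟩

/-- The image of `complEnum s` is the complement of `s`. [folklore] -/
theorem map_univ_complEnum {n : ℕ} (s : {s : Finset (Fin (2 * n)) // s.card = 4}) :
    (univ : Finset (Fin (2 * (n - 2)))).map (complEnum s) = univ \ s.1 := by
  refine Finset.eq_of_subset_of_card_le (fun y hy => ?_) ?_
  · obtain ⟨j, -, rfl⟩ := Finset.mem_map.1 hy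
    rw [← Finset.compl_eq_univ_sdiff]
    exact Finset.orderEmbOfFin_mem (s.1ᶜ) (card_compl_of_card_eq_four s) _
  · rw [Finset.card_map, Finset.card_univ, Fintype.card_fin, ← Finset.compl_eq_univ_sdiff, card_compl_of_card_eq_four s,
      two_mul_sub_two]

/-- **The subset-indexed tree remainder is the tree's `wickRemainder`**: with
`T(s) = |U₄(restrictFour x s)|` on `4`-subsets, `fsRemainder T (S₂∘(x×x)) univ = wickRemainder S₂ U₄ n x`
(`∑_{|s|=4} |U₄(x_s)| 𝒢_{n-2}[S₂](x^{(s̸)})`). [cite: AizenmanCMP1982, Prop. 12.1 (definition of R_{2n})] -/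
theorem fsRemainder_univ_eq_wickRemainder (S₂ : α → α → ℝ) (hS : ∀ a b, S₂ a b = S₂ b a)
    (U₄ : (Fin 4 → α) → ℝ) (n : ℕ) (x : Fin (2 * n) → α) :
    fsRemainder (fun s => if h : s.card = 4 then |U₄ (restrictFour x ⟨s, h⟩)| else 0)
        (fun i j => S₂ (x i) (x j)) (univ : Finset (Fin (2 * n))) = wickRemainder S₂ U₄ n x := by
  unfold fsRemainder wickRemainder
  rw [Finset.sum_subtype (univ.powersetCard 4) (p := fun s : Finset (Fin (2 * n)) => s.card = 4)
    (fun s => by simp [Finset.mem_powersetCard])]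
  refine Finset.sum_congr rfl fun s _ => ?_
  show (if h : s.1.card = 4 then |U₄ (restrictFour x ⟨s.1, h⟩)| else 0) * _ = _
  rw [dif_pos s.2]
  congr 1
  rw [removeFour₂_eq_comp, ← fsPairing_univ_eq_pairingSum S₂ hS (n - 2)]
  have hS' : ∀ a b : Fin (2 * n), S₂ (x a) (x b) = S₂ (x b) (x a) := fun a b => hS _ _
  have h := fsPairing_map (fun i j => S₂ (x i) (x j)) hS' (complEnum s) univ
  rw [map_univ_complEnum] at h
  exact h.symm

end Bridge

/-! ### The bound for current ratios in the tree's vocabulary (distinct points) -/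

section Congr

variable {ι : Type*} [LinearOrder ι]

/-- `ℛ[T,S₂](B)` only depends on the values of `T` on `4`-sets. [folklore] -/
theorem fsRemainder_congr {T T' : Finset ι → ℝ} (h : ∀ s, s.card = 4 → T s = T' s) (S₂ : ι → ι → ℝ)
    (B : Finset ι) : fsRemainder T S₂ B = fsRemainder T' S₂ B :=
  Finset.sum_congr rfl fun s hs => by rw [h s (Finset.mem_powersetCard.1 hs).2]

end Congr

/-- `∏_{i∈s} f i = ∏_{j < 4} f (s_j)` for a `4`-set enumerated increasingly (`restrictFour`). [folklore] -/
theorem prod_eq_prod_orderEmbOfFin {ι : Type*} [LinearOrder ι] {M : Type*} [CommMonoid M] (s : Finset ι) {k : ℕ}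
    (h : s.card = k) (f : ι → M) : ∏ i ∈ s, f i = ∏ j : Fin k, f (s.orderEmbOfFin h j) := by
  conv_lhs => rw [← Finset.map_orderEmbOfFin_univ s h]
  rw [Finset.prod_map]
  rfl

namespace Current

variable {V : Type*} [Fintype V] [DecidableEq V] {G : SimpleGraph V} [DecidableRel G.Adj] {K : G.edgeFinset → ℝ}

/-- **The tree-graph bound on the deviation from Wick's law for random-current ratios, distinct points,
in the tree's vocabulary**: for edge couplings `K ≥ 0` on a finite simple graph, `W(A) = Z_K[A]/Z_K[∅]`,
`W₂(a,b) = W({a}Δ{b})`, and an injective `x : Fin (2n) → V`,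
`|W({x₁,…,x_{2n}}) - 𝒢_n[W₂](x)| ≤ 2 ∑_{|s|=4} T(x_s) 𝒢_{n-2}[W₂](x^{(s̸)})` with the tree diagram
`T(u) = ∑_v ∏_j W₂(u_j, v)` (`pairingSum`, `wickRemainder` of `HighDimTrivialityWick` / `AizenmanWickBound`).
[cite: AizenmanCMP1982, Prop. 12.1 and Prop. 5.3] [cite: Panis2023Triviality, Prop. 4.6 and §4.2 (tree diagram bound)] -/
theorem abs_ratio_image_sub_pairingSum_le (hK : ∀ e, 0 ≤ K e) {n : ℕ} {x : Fin (2 * n) → V}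
    (hx : Function.Injective x) :
    |wcurrentSum K (univ.image x) / wcurrentSum K ∅ -
        pairingSum (fun a b => wcurrentSum K ({a} ∆ {b}) / wcurrentSum K ∅) n x| ≤
      2 * wickRemainder (fun a b => wcurrentSum K ({a} ∆ {b}) / wcurrentSum K ∅)
        (fun u => ∑ v, ∏ j, wcurrentSum K ({u j} ∆ {v}) / wcurrentSum K ∅) n x := by
  letI : LinearOrder V := linearOrderOfInjective (Fintype.equivFin V) (Equiv.injective _)
  set xe : Fin (2 * n) ↪ V := ⟨x, hx⟩ with hxe
  have himage : univ.image x = univ.map xe := (Finset.map_eq_image xe univ).symm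
  have heven : Even (univ.map xe).card := ⟨n, by rw [Finset.card_map, Finset.card_univ, Fintype.card_fin]; ring⟩
  have h := abs_cratio_sub_fsPairing_le hK heven
  have hsymm : ∀ a b : V, cratio K ({a} ∆ {b}) = cratio K ({b} ∆ {a}) := fun a b => by rw [symmDiff_comm]
  -- the pairing functional
  have hG : fsPairing (fun a b => cratio K ({a} ∆ {b})) (univ.map xe) =
      pairingSum (fun a b => cratio K ({a} ∆ {b})) n x := by
    rw [← fsPairing_map (fun a b => cratio K ({a} ∆ {b})) hsymm xe, ← fsPairing_univ_eq_pairingSum _ hsymm n x]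
    rfl
  -- the tree remainder
  have hR : fsRemainder (ctree K) (fun a b => cratio K ({a} ∆ {b})) (univ.map xe) =
      wickRemainder (fun a b => cratio K ({a} ∆ {b})) (fun u => ∑ v, ∏ j, cratio K ({u j} ∆ {v})) n x := by
    rw [← fsRemainder_map (ctree K) (fun a b => cratio K ({a} ∆ {b})) hsymm xe,
      ← fsRemainder_univ_eq_wickRemainder _ hsymm _ n x]
    refine fsRemainder_congr (fun s hs => ?_) _ _
    rw [dif_pos hs, abs_of_nonneg (Finset.sum_nonneg fun v _ => Finset.prod_nonneg fun j _ => cratio_nonneg hK _)]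
    simp only [ctree, Finset.prod_map]
    refine Finset.sum_congr rfl fun v _ => ?_
    rw [prod_eq_prod_orderEmbOfFin s hs]
    rfl
  rw [hG, hR] at h
  rw [himage]
  exact h

end Current

end Literature.Probability.LatticeModels

end
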